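import Literature.Topology.FourManifolds.MMSWModelBoundaryRegular
import Literature.Topology.FourManifolds.MMSWRasmussenFacts
import Literature.Topology.FourManifolds.DehnSurgeryTubularNbhdProofs
import Literature.Topology.FourManifolds.RadialExtension
import Summits.SmoothPoincare4.SmoothPoincare4.Theses.DottedCircleRasmussen

/-!
# Helper `helper_friendsCarrier_Vk_partA_boundaryFrame` (piece 3 of the registered stub
`helper_friendsCarrier_Vk_partA`, line `mk_friends`, skeleton v8) for crux `DcrGap`
(item stmt-SmoothPoincare4-16128, route route-SmoothPoincare4-DottedCircleRasmussen)

**The fibre derivatives of a tube of the model knot are transversal to a neat slice disc along the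
boundary circle, and extend radially to smooth fields off the origin.**  In Part A of V_k (the framing
theorem) the prescribed boundary values of the sought transversal framing `(n₀, n₁)` of the model slice
disc `f₁` are the fibre derivatives `bᵢ(u) = ∂_{wᵢ}|₀ νK(u, ·)` of a tube `νK : 𝕊¹ × ℝ² → M_k` of the model
knot `K₁ = f₁|_{𝕊¹}` inside the model boundary `M_k = {G_k = 1}`.  This file proves the two local facts
about them that the construction consumes:

* **transversality at the circle** (`FriendsCarrierVk.boundary_transversal`): `df₁(u) e + α b₀(u) + β b₁(u) = 0`
  only trivially.  Through the angle parametrisation `T(θ, w) = νK(e^{iθ}, w)` (a `C^∞` map of `ℝ × ℝ²`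
  with injective differential along the zero section, since `νK` is an immersion and `θ ↦ e^{iθ}` has
  non-zero velocity — the pattern of the tree's `CircleNbhd.injective_tD`, `TubeFramings.lean`) the three
  vectors `df₁(u) u^⊥ = ∂_θ T`, `b₀ = ∂_{w₀} T`, `b₁ = ∂_{w₁} T` are linearly independent and are killed
  by `dG_k` (`G_k ∘ T ≡ 1`), while NEATNESS `d/dρ G_k(f₁(ρ u)) < 0` says that `dG_k (df₁(u) u) ≠ 0`: so
  the radial component of `e` vanishes and then everything vanishes;
* **smooth radial extension** (`FriendsCarrierVk.contDiffAt_fibreDeriv_radial`): the fields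
  `x ↦ ∂_{wᵢ}|₀ νK(x/|x|, ·)` are `C^∞` off the origin (the tree's `contMDiffAt_radialProjection` and
  Mathlib's `ContDiffAt.fderiv`).

* `helper_friendsCarrier_Vk_partA_boundaryFrame` — the registered statement (both facts).

No definitions, no named facts, no `sorry`.

## References

* A. A. Kosinski, *Differential Manifolds* (1993), Ch. III (4.1)–(4.2) (neat submanifolds and their
  tubular neighbourhoods). [Kosinski1993]
* M. W. Hirsch, *Differential Topology*, GTM 33 (1976), Ch. 4 §6 (neat embeddings, collars). [Hirsch1976]
-/

-- the prescribed namespace `Summit.<P>.<Sub>.…` duplicates `SmoothPoincare4` (P = Sub)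
set_option linter.dupNamespace false
set_option linter.style.longLine false

noncomputable section

open scoped Manifold ContDiff Topology
open Set Function Metric Filter
open Literature.Topology.FourManifolds Literature.Topology.FourManifolds.MMSW

namespace Summit.SmoothPoincare4.SmoothPoincare4.Theorems.DcrGap.MkFriends

namespace FriendsCarrierVk

/-! ## The angle parametrisation of a tube -/

/-- `e^{iθ} = cos θ e₀ + sin θ e₁` in the ambient plane. [folklore] -/
theorem coe_circlePoint_eq (θ : ℝ) :
    ((circlePoint θ : sphere (0 : EuclideanSpace ℝ (Fin 2)) 1) : EuclideanSpace ℝ (Fin 2)) =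
      Real.cos θ • EuclideanSpace.single (0 : Fin 2) (1 : ℝ) + Real.sin θ • EuclideanSpace.single (1 : Fin 2) (1 : ℝ) := by
  ext i
  fin_cases i <;> simp [circlePoint_apply_zero, circlePoint_apply_one]

/-- The velocity `-sin θ e₀ + cos θ e₁` of the circle. [folklore] -/
theorem hasDerivAt_coe_circlePoint' (θ : ℝ) :
    HasDerivAt (fun t : ℝ => ((circlePoint t : sphere (0 : EuclideanSpace ℝ (Fin 2)) 1) : EuclideanSpace ℝ (Fin 2)))
      ((-Real.sin θ) • EuclideanSpace.single (0 : Fin 2) (1 : ℝ) + Real.cos θ • EuclideanSpace.single (1 : Fin 2) (1 : ℝ)) θ := by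
  have h : (fun t : ℝ => ((circlePoint t : sphere (0 : EuclideanSpace ℝ (Fin 2)) 1) : EuclideanSpace ℝ (Fin 2))) =
      fun t => Real.cos t • EuclideanSpace.single (0 : Fin 2) (1 : ℝ) + Real.sin t • EuclideanSpace.single (1 : Fin 2) (1 : ℝ) :=
    funext coe_circlePoint_eq
  rw [h]
  exact ((Real.hasDerivAt_cos θ).smul_const _).add ((Real.hasDerivAt_sin θ).smul_const _)

/-- Decomposition of a plane vector along `u = e^{iθ}` and `u^⊥ = i e^{iθ}`. [folklore] -/
theorem plane_decomp (θ : ℝ) (e : EuclideanSpace ℝ (Fin 2)) :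
    e = (e 0 * Real.cos θ + e 1 * Real.sin θ) • ((circlePoint θ : sphere (0 : EuclideanSpace ℝ (Fin 2)) 1) : EuclideanSpace ℝ (Fin 2)) +
      (-e 0 * Real.sin θ + e 1 * Real.cos θ) • ((-Real.sin θ) • EuclideanSpace.single (0 : Fin 2) (1 : ℝ) + Real.cos θ • EuclideanSpace.single (1 : Fin 2) (1 : ℝ)) := by
  have h := Real.sin_sq_add_cos_sq θ
  ext i
  fin_cases i
  · simp [circlePoint_apply_zero]
    linear_combination (-(e 0)) * h
  · simp [circlePoint_apply_one]
    linear_combination (-(e 1)) * h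

variable {k : ℕ} {K₁ : (sphere (0 : EuclideanSpace ℝ (Fin 2)) 1) → EuclideanSpace ℝ (Fin 4)}
  {f₁ : EuclideanSpace ℝ (Fin 2) → EuclideanSpace ℝ (Fin 4)}
  {νK : (sphere (0 : EuclideanSpace ℝ (Fin 2)) 1) × EuclideanSpace ℝ (Fin 2) → EuclideanSpace ℝ (Fin 4)}

/-- The angle parametrisation `(θ, w) ↦ (e^{iθ}, w)` of `𝕊¹ × ℝ²` is smooth. [folklore] -/
theorem contMDiff_angleParam : ContMDiff 𝓘(ℝ, ℝ × EuclideanSpace ℝ (Fin 2)) ((𝓡 1).prod 𝓘(ℝ, EuclideanSpace ℝ (Fin 2))) ∞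
    (fun q : ℝ × EuclideanSpace ℝ (Fin 2) => ((circlePoint q.1 : sphere (0 : EuclideanSpace ℝ (Fin 2)) 1), q.2)) :=
  (contMDiff_circlePoint.comp contDiff_fst.contMDiff).prodMk contDiff_snd.contMDiff

/-- The differential of the angle parametrisation is injective. [folklore] -/
theorem injective_mfderiv_angleParam (θ : ℝ) (w : EuclideanSpace ℝ (Fin 2)) :
    Injective (mfderiv 𝓘(ℝ, ℝ × EuclideanSpace ℝ (Fin 2)) ((𝓡 1).prod 𝓘(ℝ, EuclideanSpace ℝ (Fin 2)))
      (fun q : ℝ × EuclideanSpace ℝ (Fin 2) => ((circlePoint q.1 : sphere (0 : EuclideanSpace ℝ (Fin 2)) 1), q.2)) (θ, w)) := by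
  have hn : (∞ : WithTop ℕ∞) ≠ 0 := by simp
  set dcp : ℝ →L[ℝ] EuclideanSpace ℝ (Fin 1) := mfderiv 𝓘(ℝ, ℝ) (𝓡 1) circlePoint θ with hdcp
  set Pm : (ℝ × EuclideanSpace ℝ (Fin 2)) →L[ℝ] (EuclideanSpace ℝ (Fin 1) × EuclideanSpace ℝ (Fin 2)) :=
    (dcp.comp (ContinuousLinearMap.fst ℝ ℝ (EuclideanSpace ℝ (Fin 2)))).prod
      (ContinuousLinearMap.snd ℝ ℝ (EuclideanSpace ℝ (Fin 2))) with hPm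
  have hP : mfderiv 𝓘(ℝ, ℝ × EuclideanSpace ℝ (Fin 2)) ((𝓡 1).prod 𝓘(ℝ, EuclideanSpace ℝ (Fin 2)))
      (fun q : ℝ × EuclideanSpace ℝ (Fin 2) => ((circlePoint q.1 : sphere (0 : EuclideanSpace ℝ (Fin 2)) 1), q.2)) (θ, w) = Pm := by
    have hf : HasMFDerivAt 𝓘(ℝ, ℝ × EuclideanSpace ℝ (Fin 2)) (𝓡 1)
        (fun q : ℝ × EuclideanSpace ℝ (Fin 2) => circlePoint q.1) (θ, w)
        (dcp.comp (ContinuousLinearMap.fst ℝ ℝ (EuclideanSpace ℝ (Fin 2)))) := by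
      have h2 : HasMFDerivAt 𝓘(ℝ, ℝ × EuclideanSpace ℝ (Fin 2)) 𝓘(ℝ, ℝ) (Prod.fst : ℝ × EuclideanSpace ℝ (Fin 2) → ℝ) (θ, w)
          (ContinuousLinearMap.fst ℝ ℝ (EuclideanSpace ℝ (Fin 2))) :=
        (ContinuousLinearMap.fst ℝ ℝ (EuclideanSpace ℝ (Fin 2))).hasFDerivAt.hasMFDerivAt
      exact (contMDiff_circlePoint.mdifferentiableAt hn).hasMFDerivAt.comp (θ, w) h2
    have hs : HasMFDerivAt 𝓘(ℝ, ℝ × EuclideanSpace ℝ (Fin 2)) 𝓘(ℝ, EuclideanSpace ℝ (Fin 2))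
        (Prod.snd : ℝ × EuclideanSpace ℝ (Fin 2) → EuclideanSpace ℝ (Fin 2)) (θ, w)
        (ContinuousLinearMap.snd ℝ ℝ (EuclideanSpace ℝ (Fin 2))) :=
      (ContinuousLinearMap.snd ℝ ℝ (EuclideanSpace ℝ (Fin 2))).hasFDerivAt.hasMFDerivAt
    exact (hf.prodMk hs).mfderiv
  have key : ∀ a : ℝ, dcp a = a • dcp 1 := fun a => by
    have h := dcp.map_smul a (1 : ℝ)
    rw [smul_eq_mul, mul_one] at h
    exact h
  have hne : dcp 1 ≠ 0 := mfderiv_circlePoint_apply_ne_zero θ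
  rw [hP]
  intro v v' hvv'
  have h3 := congrArg Prod.fst hvv'
  have hb := congrArg Prod.snd hvv'
  change dcp v.1 = dcp v'.1 at h3
  change v.2 = v'.2 at hb
  rw [key v.1, key v'.1] at h3
  have h4 : (v.1 - v'.1) • dcp 1 = 0 := by rw [sub_smul, h3, sub_self]
  rcases smul_eq_zero.mp h4 with h5 | h5
  · exact Prod.ext (sub_eq_zero.mp h5) hb
  · exact absurd h5 hne

variable (hν : ContMDiff ((𝓡 1).prod 𝓘(ℝ, EuclideanSpace ℝ (Fin 2))) 𝓘(ℝ, EuclideanSpace ℝ (Fin 4)) ∞ νK)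
include hν

/-- The angle parametrisation `T(θ, w) = νK(e^{iθ}, w)` of the tube is `C^∞` on `ℝ × ℝ²`. [folklore] -/
theorem contDiff_angleTube : ContDiff ℝ ∞ fun q : ℝ × EuclideanSpace ℝ (Fin 2) =>
    νK ((circlePoint q.1 : sphere (0 : EuclideanSpace ℝ (Fin 2)) 1), q.2) :=
  contMDiff_iff_contDiff.1 (hν.comp contMDiff_angleParam)

/-- **The differential of `T(θ, w) = νK(e^{iθ}, w)` is injective** where `νK` is an immersion. [folklore] -/
theorem injective_fderiv_angleTube
    (hνimm : ∀ p, Injective (mfderiv ((𝓡 1).prod 𝓘(ℝ, EuclideanSpace ℝ (Fin 2))) 𝓘(ℝ, EuclideanSpace ℝ (Fin 4)) νK p))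
    (θ : ℝ) (w : EuclideanSpace ℝ (Fin 2)) :
    Injective (fderiv ℝ (fun q : ℝ × EuclideanSpace ℝ (Fin 2) =>
      νK ((circlePoint q.1 : sphere (0 : EuclideanSpace ℝ (Fin 2)) 1), q.2)) (θ, w)) := by
  have hn : (∞ : WithTop ℕ∞) ≠ 0 := by simp
  rw [← mfderiv_eq_fderiv]
  have h := mfderiv_comp (θ, w) ((hν _).mdifferentiableAt hn) (contMDiff_angleParam.mdifferentiableAt hn)
    (I := 𝓘(ℝ, ℝ × EuclideanSpace ℝ (Fin 2)))
  change mfderiv 𝓘(ℝ, ℝ × EuclideanSpace ℝ (Fin 2)) 𝓘(ℝ, EuclideanSpace ℝ (Fin 4))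
    (νK ∘ fun q : ℝ × EuclideanSpace ℝ (Fin 2) => ((circlePoint q.1 : sphere (0 : EuclideanSpace ℝ (Fin 2)) 1), q.2)) (θ, w) = _ at h
  change Injective (mfderiv 𝓘(ℝ, ℝ × EuclideanSpace ℝ (Fin 2)) 𝓘(ℝ, EuclideanSpace ℝ (Fin 4))
    (νK ∘ fun q : ℝ × EuclideanSpace ℝ (Fin 2) => ((circlePoint q.1 : sphere (0 : EuclideanSpace ℝ (Fin 2)) 1), q.2)) (θ, w))
  rw [h]
  exact (hνimm _).comp (injective_mfderiv_angleParam θ w)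

omit hν in
/-- The fibre derivative `∂_w|₀ νK(u, ·) v` is the differential of the angle tube on `(0, v)`. [folklore] -/
theorem fderiv_fibre_eq_angleTube (hT : ContDiff ℝ ∞ fun q : ℝ × EuclideanSpace ℝ (Fin 2) =>
      νK ((circlePoint q.1 : sphere (0 : EuclideanSpace ℝ (Fin 2)) 1), q.2))
    (θ : ℝ) (v : EuclideanSpace ℝ (Fin 2)) :
    fderiv ℝ (fun w : EuclideanSpace ℝ (Fin 2) => νK (circlePoint θ, w)) 0 v =
      fderiv ℝ (fun q : ℝ × EuclideanSpace ℝ (Fin 2) =>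
        νK ((circlePoint q.1 : sphere (0 : EuclideanSpace ℝ (Fin 2)) 1), q.2)) (θ, 0) ((0 : ℝ), v) := by
  have hj : HasFDerivAt (fun w : EuclideanSpace ℝ (Fin 2) => ((θ, w) : ℝ × EuclideanSpace ℝ (Fin 2)))
      (ContinuousLinearMap.inr ℝ ℝ (EuclideanSpace ℝ (Fin 2))) 0 :=
    (hasFDerivAt_const θ (0 : EuclideanSpace ℝ (Fin 2))).prodMk (hasFDerivAt_id (0 : EuclideanSpace ℝ (Fin 2)))
  have hd : HasFDerivAt (fun q : ℝ × EuclideanSpace ℝ (Fin 2) =>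
      νK ((circlePoint q.1 : sphere (0 : EuclideanSpace ℝ (Fin 2)) 1), q.2)) (fderiv ℝ (fun q : ℝ × EuclideanSpace ℝ (Fin 2) =>
        νK ((circlePoint q.1 : sphere (0 : EuclideanSpace ℝ (Fin 2)) 1), q.2)) (θ, 0)) (θ, 0) :=
    ((hT.differentiable (by simp)) _).hasFDerivAt
  have h : HasFDerivAt (fun w : EuclideanSpace ℝ (Fin 2) => νK (circlePoint θ, w))
      ((fderiv ℝ (fun q : ℝ × EuclideanSpace ℝ (Fin 2) =>
        νK ((circlePoint q.1 : sphere (0 : EuclideanSpace ℝ (Fin 2)) 1), q.2)) (θ, 0)).comp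
        (ContinuousLinearMap.inr ℝ ℝ (EuclideanSpace ℝ (Fin 2)))) 0 :=
    hd.comp (0 : EuclideanSpace ℝ (Fin 2)) hj
  rw [h.fderiv]
  rfl

/-! ## Transversality at the boundary circle -/

/-- **Transversality of the fibre derivatives of the tube to a neat slice disc at the circle.**
[cite: Kosinski1993, Ch. III Thm (4.2)] -/
theorem boundary_transversal (hf : IsModelSliceDisc k K₁ f₁)
    (hneat : ∀ t : (sphere (0 : EuclideanSpace ℝ (Fin 2)) 1), deriv (fun ρ : ℝ => levelFun k (f₁ (ρ • (t : EuclideanSpace ℝ (Fin 2))))) 1 < 0)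
    (hνimm : ∀ p, Injective (mfderiv ((𝓡 1).prod 𝓘(ℝ, EuclideanSpace ℝ (Fin 2))) 𝓘(ℝ, EuclideanSpace ℝ (Fin 4)) νK p))
    (hνM : ∀ p, νK p ∈ modelBoundary k) (hν0 : ∀ u : (sphere (0 : EuclideanSpace ℝ (Fin 2)) 1), νK (u, 0) = K₁ u)
    (u : (sphere (0 : EuclideanSpace ℝ (Fin 2)) 1)) (e : EuclideanSpace ℝ (Fin 2)) (α β : ℝ)
    (h : fderiv ℝ f₁ u e + α • fderiv ℝ (fun w : EuclideanSpace ℝ (Fin 2) => νK (u, w)) 0 (EuclideanSpace.single 0 1) +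
      β • fderiv ℝ (fun w : EuclideanSpace ℝ (Fin 2) => νK (u, w)) 0 (EuclideanSpace.single 1 1) = 0) :
    e = 0 ∧ α = 0 ∧ β = 0 := by
  obtain ⟨θ, rfl⟩ := circlePoint_surjective u
  have hfs : ContDiff ℝ ∞ f₁ := contMDiff_iff_contDiff.1 hf.1
  have hT := contDiff_angleTube hν
  set T : ℝ × EuclideanSpace ℝ (Fin 2) → EuclideanSpace ℝ (Fin 4) := fun q =>
    νK ((circlePoint q.1 : sphere (0 : EuclideanSpace ℝ (Fin 2)) 1), q.2) with hTdef
  set DT := fderiv ℝ T (θ, 0) with hDT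
  have hDTinj : Injective DT := injective_fderiv_angleTube hν hνimm θ 0
  -- the fibre derivatives through `DT`
  have hb : ∀ v : EuclideanSpace ℝ (Fin 2), fderiv ℝ (fun w : EuclideanSpace ℝ (Fin 2) => νK (circlePoint θ, w)) 0 v = DT ((0 : ℝ), v) :=
    fun v => fderiv_fibre_eq_angleTube hT θ v
  -- the angular derivative through `DT`: `DT (1, 0) = df₁(u) u^⊥`
  set tv : EuclideanSpace ℝ (Fin 2) := (-Real.sin θ) • EuclideanSpace.single (0 : Fin 2) (1 : ℝ) + Real.cos θ • EuclideanSpace.single (1 : Fin 2) (1 : ℝ) with htv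
  have hT0 : ∀ θ' : ℝ, T (θ', 0) = f₁ ((circlePoint θ' : sphere (0 : EuclideanSpace ℝ (Fin 2)) 1) : EuclideanSpace ℝ (Fin 2)) := fun θ' => by
    simp only [hTdef, hν0, hf.2.2.2.2]
  have hang : DT ((1 : ℝ), (0 : EuclideanSpace ℝ (Fin 2))) = fderiv ℝ f₁ (circlePoint θ) tv := by
    have hj : HasDerivAt (fun θ' : ℝ => ((θ', (0 : EuclideanSpace ℝ (Fin 2))) : ℝ × EuclideanSpace ℝ (Fin 2)))
        ((1 : ℝ), (0 : EuclideanSpace ℝ (Fin 2))) θ := by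
      have := (hasDerivAt_id θ).prodMk (hasDerivAt_const θ (0 : EuclideanSpace ℝ (Fin 2)))
      simpa using this
    have hd : HasFDerivAt T DT (θ, 0) := ((hT.differentiable (by simp)) _).hasFDerivAt
    have h1 := hd.comp_hasDerivAt θ hj
    have h2 : HasDerivAt (fun θ' : ℝ => f₁ ((circlePoint θ' : sphere (0 : EuclideanSpace ℝ (Fin 2)) 1) : EuclideanSpace ℝ (Fin 2)))
        (fderiv ℝ f₁ (circlePoint θ) tv) θ :=
      ((hfs.differentiable (by simp)) _).hasFDerivAt.comp_hasDerivAt θ (hasDerivAt_coe_circlePoint' θ)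
    have e : (T ∘ fun θ' : ℝ => ((θ', (0 : EuclideanSpace ℝ (Fin 2))) : ℝ × EuclideanSpace ℝ (Fin 2))) =
        fun θ' : ℝ => f₁ ((circlePoint θ' : sphere (0 : EuclideanSpace ℝ (Fin 2)) 1) : EuclideanSpace ℝ (Fin 2)) :=
      funext hT0
    rw [e] at h1
    exact h1.unique h2
  -- the level function kills the image of `DT`
  have hmem : T (θ, 0) ∈ modelBoundary k := hνM _
  have hGd : DifferentiableAt ℝ (levelFun k) (T (θ, 0)) :=
    (contDiffAt_levelFun (holeTerm_ne_zero_of_mem_modelBoundary hmem)).differentiableAt (by simp)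
  set L := fderiv ℝ (levelFun k) (T (θ, 0)) with hL
  have hLDT : ∀ d : ℝ × EuclideanSpace ℝ (Fin 2), L (DT d) = 0 := fun d => by
    have hconst : (fun q => levelFun k (T q)) = fun _ => (1 : ℝ) := funext fun q => (hνM _).2
    have hd : HasFDerivAt (fun q => levelFun k (T q)) (L.comp DT) (θ, 0) :=
      hGd.hasFDerivAt.comp (θ, 0) ((hT.differentiable (by simp)) _).hasFDerivAt
    have h0 : HasFDerivAt (fun q : ℝ × EuclideanSpace ℝ (Fin 2) => levelFun k (T q)) (0 : ℝ × EuclideanSpace ℝ (Fin 2) →L[ℝ] ℝ) (θ, 0) := by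
      rw [hconst]; exact hasFDerivAt_const _ _
    have := hd.unique h0
    have := congrArg (fun f : ℝ × EuclideanSpace ℝ (Fin 2) →L[ℝ] ℝ => f d) this
    simpa using this
  -- neatness: the radial derivative is not killed
  have hTu : T (θ, 0) = f₁ (circlePoint θ) := hT0 θ
  have hrad : L (fderiv ℝ f₁ (circlePoint θ) (circlePoint θ)) < 0 := by
    have hline : HasDerivAt (fun ρ : ℝ => ρ • ((circlePoint θ : sphere (0 : EuclideanSpace ℝ (Fin 2)) 1) : EuclideanSpace ℝ (Fin 2)))
        ((circlePoint θ : sphere (0 : EuclideanSpace ℝ (Fin 2)) 1) : EuclideanSpace ℝ (Fin 2)) 1 := by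
      simpa using (hasDerivAt_id (1 : ℝ)).smul_const ((circlePoint θ : sphere (0 : EuclideanSpace ℝ (Fin 2)) 1) : EuclideanSpace ℝ (Fin 2))
    have hGd' : DifferentiableAt ℝ (levelFun k) (f₁ (circlePoint θ)) := by rw [← hTu]; exact hGd
    have hcomp : HasFDerivAt (fun y => levelFun k (f₁ y)) ((fderiv ℝ (levelFun k) (f₁ (circlePoint θ))).comp (fderiv ℝ f₁ (circlePoint θ)))
        ((circlePoint θ : sphere (0 : EuclideanSpace ℝ (Fin 2)) 1) : EuclideanSpace ℝ (Fin 2)) :=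
      hGd'.hasFDerivAt.comp _ ((hfs.differentiable (by simp)) _).hasFDerivAt
    have h1 : HasDerivAt (fun ρ : ℝ => levelFun k (f₁ (ρ • ((circlePoint θ : sphere (0 : EuclideanSpace ℝ (Fin 2)) 1) : EuclideanSpace ℝ (Fin 2)))))
        (fderiv ℝ (levelFun k) (f₁ (circlePoint θ)) (fderiv ℝ f₁ (circlePoint θ) (circlePoint θ))) 1 :=
      hcomp.comp_hasDerivAt_of_eq 1 hline (by simp)
    have := hneat (circlePoint θ)
    rw [h1.deriv] at this
    rw [hL, hTu]
    exact this
  -- apply `L` to the relation: the radial component of `e` vanishes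
  rw [hb, hb] at h
  have hLf : L (fderiv ℝ f₁ (circlePoint θ) e) = 0 := by
    have := congrArg L h
    rw [map_add, map_add, map_smul, map_smul, hLDT, hLDT, map_zero] at this
    simpa using this
  have hdec := plane_decomp θ e
  set er : ℝ := e 0 * Real.cos θ + e 1 * Real.sin θ with her
  set et : ℝ := -e 0 * Real.sin θ + e 1 * Real.cos θ with het
  have hLt : L (fderiv ℝ f₁ (circlePoint θ) tv) = 0 := by rw [← hang]; exact hLDT _
  have her0 : er = 0 := by
    rw [hdec, map_add, map_smul, map_smul, map_add, map_smul, map_smul, hLt, smul_zero, add_zero, smul_eq_mul] at hLf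
    rcases mul_eq_zero.1 hLf with h0 | h0
    · exact h0
    · exact absurd h0 hrad.ne
  have he : e = et • tv := by rw [hdec, her0, zero_smul, zero_add]
  -- the remaining relation lies in the image of the injective `DT`
  rw [he, map_smul, ← hang, ← map_smul, ← map_smul, ← map_smul, ← map_add, ← map_add] at h
  have hzero : et • ((1 : ℝ), (0 : EuclideanSpace ℝ (Fin 2))) + α • ((0 : ℝ), EuclideanSpace.single (0 : Fin 2) (1 : ℝ)) +
      β • ((0 : ℝ), EuclideanSpace.single (1 : Fin 2) (1 : ℝ)) = 0 :=
    (injective_iff_map_eq_zero DT).1 hDTinj _ h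
  have h1 := congrArg Prod.fst hzero
  have h2 := congrArg (fun q : ℝ × EuclideanSpace ℝ (Fin 2) => q.2 0) hzero
  have h3 := congrArg (fun q : ℝ × EuclideanSpace ℝ (Fin 2) => q.2 1) hzero
  simp at h1 h2 h3
  refine ⟨?_, h2, h3⟩
  rw [he, h1, zero_smul]

/-! ## Smooth radial extension of the fibre derivatives -/

/-- **The radially extended fibre derivative `x ↦ ∂_{wᵢ}|₀ νK(x/|x|, ·)` is `C^∞` off the origin.** [folklore] -/
theorem contDiffAt_fibreDeriv_radial (u₀ : (sphere (0 : EuclideanSpace ℝ (Fin 2)) 1)) (v : EuclideanSpace ℝ (Fin 2))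
    {x : EuclideanSpace ℝ (Fin 2)} (hx : x ≠ 0) :
    ContDiffAt ℝ ∞ (fun y : EuclideanSpace ℝ (Fin 2) =>
      fderiv ℝ (fun w : EuclideanSpace ℝ (Fin 2) => νK (radialProjection u₀ y, w)) 0 v) x := by
  -- the map `(y, w) ↦ νK (y/|y|, w)` is `C^∞` near `{x} × ℝ²`
  have hΦ : ∀ w : EuclideanSpace ℝ (Fin 2), ContDiffAt ℝ ∞
      (uncurry fun (y : EuclideanSpace ℝ (Fin 2)) (w : EuclideanSpace ℝ (Fin 2)) => νK (radialProjection u₀ y, w)) (x, w) := by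
    intro w
    have h1 : ContMDiffAt 𝓘(ℝ, EuclideanSpace ℝ (Fin 2) × EuclideanSpace ℝ (Fin 2)) ((𝓡 1).prod 𝓘(ℝ, EuclideanSpace ℝ (Fin 2))) ∞
        (fun q : EuclideanSpace ℝ (Fin 2) × EuclideanSpace ℝ (Fin 2) => (radialProjection u₀ q.1, q.2)) (x, w) :=
      ((contMDiffAt_radialProjection u₀ hx).comp (x, w) (contDiffAt_fst.contMDiffAt)).prodMk contDiffAt_snd.contMDiffAt
    have h2 := (hν _).comp (x, w) h1
    exact contMDiffAt_iff_contDiffAt.1 h2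
  have h := (hΦ 0).fderiv (contDiffAt_const (c := (0 : EuclideanSpace ℝ (Fin 2)))) (m := ∞) (by simp)
  exact h.clm_apply contDiffAt_const

end FriendsCarrierVk

open FriendsCarrierVk in
/-- **Helper `helper_friendsCarrier_Vk_partA_boundaryFrame`** (piece of `helper_friendsCarrier_Vk_partA`: the
boundary values of the framing).  For a neat model slice disc `f₁` of the model knot `K₁` and a tube
`νK : 𝕊¹ × ℝ² → M_k` of `K₁` (`C^∞` immersion with `νK(u, 0) = K₁ u`): (1) along the circle the fibre
derivatives `∂_{w₀}|₀ νK(u, ·)`, `∂_{w₁}|₀ νK(u, ·)` are transversal to the disc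
(`df₁(u) e + α b₀ + β b₁ = 0` only trivially); (2) their radial extensions `x ↦ ∂_{wᵢ}|₀ νK(x/|x|, ·)` are
`C^∞` off the origin. [cite: Kosinski1993, Ch. III Thm (4.2)] -/
theorem helper_friendsCarrier_Vk_partA_boundaryFrame : ∀ (k : ℕ) (K₁ : (Metric.sphere (0 : EuclideanSpace ℝ (Fin 2)) 1) → EuclideanSpace ℝ (Fin 4)) (f₁ : EuclideanSpace ℝ (Fin 2) → EuclideanSpace ℝ (Fin 4)) (νK : (Metric.sphere (0 : EuclideanSpace ℝ (Fin 2)) 1) × EuclideanSpace ℝ (Fin 2) → EuclideanSpace ℝ (Fin 4)), Literature.Topology.FourManifolds.MMSW.IsModelSliceDisc k K₁ f₁ → (∀ t : (Metric.sphere (0 : EuclideanSpace ℝ (Fin 2)) 1), deriv (fun ρ : ℝ => Literature.Topology.FourManifolds.MMSW.levelFun k (f₁ (ρ • (t : EuclideanSpace ℝ (Fin 2))))) 1 < 0) → ContMDiff ((𝓡 1).prod 𝓘(ℝ, EuclideanSpace ℝ (Fin 2))) 𝓘(ℝ, EuclideanSpace ℝ (Fin 4)) ((⊤ : ℕ∞)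 : WithTop ℕ∞) νK → (∀ p, Function.Injective (mfderiv ((𝓡 1).prod 𝓘(ℝ, EuclideanSpace ℝ (Fin 2))) 𝓘(ℝ, EuclideanSpace ℝ (Fin 4)) νK p)) → (∀ p, νK p ∈ Literature.Topology.FourManifolds.MMSW.modelBoundary k) → (∀ u : (Metric.sphere (0 : EuclideanSpace ℝ (Fin 2)) 1), νK (u, 0) = K₁ u) → (∀ (u : (Metric.sphere (0 : EuclideanSpace ℝ (Fin 2)) 1)) (e : EuclideanSpace ℝ (Fin 2)) (α β : ℝ), fderiv ℝ f₁ u e + α • fderiv ℝ (fun w : EuclideanSpace ℝ (Fin 2) => νK (u, w)) 0 (EuclideanSpace.single 0 1) + β • fderiv ℝ (fun w : EuclideanSpace ℝ (Fin 2) => νK (u, w)) 0 (EuclideanSpace.single 1 1) = 0 → e = 0 ∧ α = 0 ∧ β = 0) ∧ ∀ (u₀ : (Metric.sphere (0 : EuclideanSpace ℝ (Fin 2)) 1)) (v x : EuclideanSpace ℝ (Fin 2)), x ≠ 0 → ContDiffAt ℝ ((⊤ : ℕ∞) : WithTop ℕ∞) (fun y : EuclideanSpace ℝ (Fin 2) =>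 fderiv ℝ (fun w : EuclideanSpace ℝ (Fin 2) => νK (Literature.Topology.FourManifolds.radialProjection u₀ y, w)) 0 v) x := by
  intro k K₁ f₁ νK hf hneat hν hνimm hνM hν0
  exact ⟨fun u e α β h => boundary_transversal hν hf hneat hνimm hνM hν0 u e α β h,
    fun u₀ v x hx => contDiffAt_fibreDeriv_radial hν u₀ v hx⟩

end Summit.SmoothPoincare4.SmoothPoincare4.Theorems.DcrGap.MkFriends

end
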